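import Summits.CriticalPhenomena.PercolationContinuityZ3.Theorems.PercNearOneGluingNoHeavyLowerTailMajorityGluingQCertSym3Parts
import Summits.CriticalPhenomena.PercolationContinuityZ3.Theorems.PercNearOneGluingNoHeavyLowerTailMajorityGluingQCertSym3EightFive
import Summits.CriticalPhenomena.PercolationContinuityZ3.Theorems.PercNearOneGluingNoHeavyLowerTailMajorityGluingEightHarris
import HarnessLib

/-!
# Five of eight relays cut from the hub: `μ ≤ (5/4)·max_i μ(vᵢ ↮ a₀)` by a kernel-checked ORBIT certificate; `C(10), C(11) ≤ 9/4`, `= 2` for `max ≥ 1/5` (lane prim-rate, constants-miner 1, gen 36; CANDIDATES §GEN-36)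

Support file for the closed crux `NoHeavyLowerTail` (stmt-CriticalPhenomena-4575), majority-gluing line.  The ROOT CELL `R_5 = (8,5)` of the window (it closes
`|A| = 10` and, by the cell monotonicity `cutCount_mono`, `|A| = 11`) gets a kernel-checked symmetrised Positivstellensatz certificate `QCert.eightFiveSym3` (kit j290755: symlp3.py — the S_m-SYMMETRISED DEGREE-3 moment LP (triple-orbit pseudo-moments; ALL hub-rooted van den Berg–Kahn row orbits × lift variables and `2×2` square orbits × lift variables separated exhaustively up to symmetry; chain-free); exact integer multipliers; re-verified in the Lean semantics by cert/mksym3.py; ONE representative per relabelling orbit; the kernel evaluation is split into parts with verified digests (`…MajorityGluing{checkmod}P*`) glued in `…MajorityGluing{checkmod}`):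
**`fiveOfEight_eightFiveSym3` : `μ(5 ≤ #{v ∈ T : v ↮ a₀}) ≤ (5/4)·δ`** for every finite weighted graph, hub `a₀`, `8`-set `T` and `δ ≥` the cut probabilities (an instance of the
generic `QCert.SymCert3.cut_of_posS3_count`).  Consequences via `cutCount_mono` and the generic Harris layer of `…MajorityGluingEightHarris`:
**`majorityGluing_card_ten_eleven_eightFiveSym3` : `C(10), C(11) ≤ 9/4`** (g35´s tree had 47/20 (degree-2 certificate over all 1 333 row instances); this generation´s degree-2 orbit certificates gave 82/35 (k = 10) and 113/50 (k = 11)),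
**`majorityGluing_two_card_ten_eleven_of_ge_eightFiveSym3` : `C(10) = C(11) = 2` whenever `max ≥ 1/5`**, and the Harris form `δ₀ + (5/4)δ₀(1 − δ₀)`.  No sorries.
[cite: VandenbergKahn2001, Thm 1.2 (p. 123)] [cite: KozmaNitzan2024, Conj. 1 (p. 3), Conj. 4 (p. 32)]
-/

noncomputable section

namespace Summit.CriticalPhenomena.PercolationContinuityZ3.Theorems

open MeasureTheory Set
open Literature.Probability.LatticeModels (prodBernoulli)
open Literature.Probability.Percolation
open scoped Classical

namespace HubOnly

variable {n : ℕ}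

/-- **AT LEAST FIVE OF EIGHT RELAYS CUT: `μ ≤ (5/4)·δ`** for every finite weighted graph, hub `a₀`, `8`-set `T` and `δ` bounding the cut probabilities — the
kernel-checked certificate `QCert.eightFiveSym3`. [cite: VandenbergKahn2001, Thm 1.2 (p. 123)] -/
theorem fiveOfEight_eightFiveSym3 (w : Sym2 (Fin n) → unitInterval) (a₀ : Fin n) (T : Finset (Fin n)) (hT : T.card = 8) (δ : ℝ)
    (hδ : ∀ v ∈ T, (prodBernoulli w).real (openConn v a₀ : Set (BondConfig (Fin n)))ᶜ ≤ δ) :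
    (prodBernoulli w).real {ω : BondConfig (Fin n) | 5 ≤ (T.filter fun v => ω ∉ openConn v a₀).card} ≤ 5 / 4 * δ := by
  obtain ⟨v, hv⟩ : T.Nonempty := by rw [← Finset.card_pos, hT]; norm_num
  have hδ0 : 0 ≤ δ := le_trans measureReal_nonneg (hδ v hv)
  have h := QCert.SymCert3.cut_of_posS3_count QCert.eightFiveSym3 QCert.eightFiveSym3_m QCert.eightFiveSym3_checkWS QCert.eightFiveSym3_pos w a₀ T hT δ hδ0 hδ
  rw [QCert.eightFiveSym3_base] at h
  have hcD : (QCert.eightFiveSym3Base.cD : ℝ) = 4 := by norm_num [QCert.eightFiveSym3Base]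
  have hcN : (QCert.eightFiveSym3Base.cN : ℝ) = 5 := by norm_num [QCert.eightFiveSym3Base]
  have hh : QCert.eightFiveSym3Base.h = 5 := rfl
  rw [hcD, hcN, hh] at h
  linarith

/-- The cell(s) of `|A| ∈ {10, 11}` obey the constant bound `(5/4)·δ` (via the cell monotonicity `cutCount_mono`). [cite: VandenbergKahn2001, Thm 1.2 (p. 123)] -/
theorem cell_ten_eleven_eightFiveSym3 (p : Sym2 (Fin n) → unitInterval) (A : Finset (Fin n)) (a₀ : Fin n) (hA1 : 10 ≤ A.card) (hA2 : A.card ≤ 11)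
    (T : Finset (Fin n)) (δ : ℝ) (haT : a₀ ∉ T) (_hTA : T ⊆ A) (hTcard : T.card + 2 = A.card) (_hδ : 0 ≤ δ)
    (hδT : ∀ v ∈ T, (prodBernoulli p).real (openConn v a₀ : Set (BondConfig (Fin n)))ᶜ ≤ δ) :
    (prodBernoulli p).real {ω : BondConfig (Fin n) | (A.card + 1) / 2 ≤ (T.filter fun v => ω ∉ openConn v a₀).card} ≤ 5 / 4 * δ :=
  cutCount_mono p a₀ 8 5 δ (5 / 4 * δ) (fun T₀ hT₀ _ hδT₀ => fiveOfEight_eightFiveSym3 p a₀ T₀ hT₀ δ hδT₀) T ((A.card + 1) / 2)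
    (by omega) (by omega) haT hδT

/-- **MAJORITY GLUING AT `|A| ∈ {10, 11}` WITH LOSS `(9/4)·max`:** `μ(o ↔ A) − (9/4)δ₀ ≤ μ(o ↔ a₀ ∧ 2N > |A|)` for every weight function, observer,
hub `a₀ ∈ A`, `|A| ∈ {10, 11}`, `δ₀ ≥ max_{a∈A} μ(a ↮ a₀)`. [cite: VandenbergKahn2001, Thm 1.2 (p. 123)] [cite: KozmaNitzan2024, Conj. 1 (p. 3)] -/
theorem majorityGluing_card_ten_eleven_eightFiveSym3 (w : Sym2 (Fin n) → unitInterval) (A : Finset (Fin n)) (o a₀ : Fin n) (δ₀ : ℝ)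
    (ha₀ : a₀ ∈ A) (hA1 : 10 ≤ A.card) (hA2 : A.card ≤ 11)
    (hδ₀ : ∀ a ∈ A, (prodBernoulli w).real (openConn a a₀ : Set (BondConfig (Fin n)))ᶜ ≤ δ₀) :
    (prodBernoulli w).real (⋃ a ∈ A, openConn o a) - 9 / 4 * δ₀ ≤
      (prodBernoulli w).real {ω : BondConfig (Fin n) | ω ∈ openConn o a₀ ∧
          A.card < 2 * (A.filter fun a => ω ∈ openConn o a).card} := by
  have h := majorityGluing_of_cellConst w A o a₀ δ₀ ha₀ (by omega) (5 / 4) (by norm_num)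
    (fun p _ T δ haT hTA hTcard hδ hδT => cell_ten_eleven_eightFiveSym3 p A a₀ hA1 hA2 T δ haT hTA hTcard hδ hδT) hδ₀
  norm_num at h ⊢
  linarith

/-- **MAJORITY GLUING AT `|A| ∈ {10, 11}`, HARRIS FORM:** loss `δ₀ + (5/4)·δ₀·(1 − δ₀)` for `max_{a∈A} μ(a ↮ a₀) ≤ δ₀ ≤ 4/5`.
[cite: VandenbergKahn2001, Thm 1.2 (p. 123)] [cite: KozmaNitzan2024, Conj. 1 (p. 3)] -/
theorem majorityGluing_harris_card_ten_eleven_eightFiveSym3 (w : Sym2 (Fin n) → unitInterval) (A : Finset (Fin n)) (o a₀ : Fin n) (δ₀ : ℝ)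
    (ha₀ : a₀ ∈ A) (hA1 : 10 ≤ A.card) (hA2 : A.card ≤ 11)
    (hδ₀ : ∀ a ∈ A, (prodBernoulli w).real (openConn a a₀ : Set (BondConfig (Fin n)))ᶜ ≤ δ₀) (hδ₀' : δ₀ ≤ 4 / 5) :
    (prodBernoulli w).real (⋃ a ∈ A, openConn o a) -
        (prodBernoulli w).real {ω : BondConfig (Fin n) | ω ∈ openConn o a₀ ∧
          A.card < 2 * (A.filter fun a => ω ∈ openConn o a).card}
      ≤ δ₀ + 5 / 4 * δ₀ * (1 - δ₀) :=
  majorityGluing_harris_of_cellConst w A o a₀ δ₀ ha₀ (by omega) (5 / 4) (by norm_num)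
    (fun p _ T δ haT hTA hTcard hδ hδT => cell_ten_eleven_eightFiveSym3 p A a₀ hA1 hA2 T δ haT hTA hTcard hδ hδT) hδ₀ (by linarith)

/-- **`C(10) = C(11) = 2` WHENEVER `max ≥ 1/5`:** `μ(o ↔ A) − 2δ₀ ≤ μ(o ↔ a₀ ∧ 2N > |A|)` for `|A| ∈ {10, 11}`, `δ₀ ≥ max_{a∈A} μ(a ↮ a₀)`, `δ₀ ≥ 1/5`.
[cite: VandenbergKahn2001, Thm 1.2 (p. 123)] [cite: KozmaNitzan2024, Conj. 1 (p. 3), Conj. 4 (p. 32)] -/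
theorem majorityGluing_two_card_ten_eleven_of_ge_eightFiveSym3 (w : Sym2 (Fin n) → unitInterval) (A : Finset (Fin n)) (o a₀ : Fin n) (δ₀ : ℝ)
    (ha₀ : a₀ ∈ A) (hA1 : 10 ≤ A.card) (hA2 : A.card ≤ 11)
    (hδ₀ : ∀ a ∈ A, (prodBernoulli w).real (openConn a a₀ : Set (BondConfig (Fin n)))ᶜ ≤ δ₀) (hreg : 1 / 5 ≤ δ₀) :
    (prodBernoulli w).real (⋃ a ∈ A, openConn o a) - 2 * δ₀ ≤
      (prodBernoulli w).real {ω : BondConfig (Fin n) | ω ∈ openConn o a₀ ∧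
          A.card < 2 * (A.filter fun a => ω ∈ openConn o a).card} :=
  majorityGluing_two_of_cellConst w A o a₀ δ₀ ha₀ (by omega) (5 / 4) (by norm_num)
    (fun p _ T δ haT hTA hTcard hδ hδT => cell_ten_eleven_eightFiveSym3 p A a₀ hA1 hA2 T δ haT hTA hTcard hδ hδT) hδ₀ (by linarith)

end HubOnly

end Summit.CriticalPhenomena.PercolationContinuityZ3.Theorems

end
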